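/-
Copyright: the b2b-balaban T⁴-continuum CRUX team, row NE7b leaf lineage `t4-ne7b-formalise-leaf-03` (gen 148). Project licence.
-/
import Mathlib.Analysis.InnerProductSpace.LaxMilgram
import Mathlib.Analysis.InnerProductSpace.Dual

/-!
# THE HARD STEP'S AUGMENTED HESSIAN `h ↦ (D h, Q h|_{ker D})` IS AN EQUIVALENCE WITH `‖T⁻¹‖ ≤ (1 + ‖Q‖∕m)‖M‖ + m⁻¹`
# FROM KERNEL COERCIVITY ALONE — the two DISPLAYED chart letters `T`, `‖T⁻¹ y‖ ≤ N‖y‖` of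
# `…HardStepChartRadius.exists_criticalBranch_chart_ker` (and of `…HardStepBranchDeriv`) SUPPLIED with an explicit `N`
# (row NE7b, node U5c; idea-1 T-93 (b) «implicit function ∕ contraction on a chart, WITH CONSTANTS»: [B11] CMP 102 (70)–(71)
# «uniquely solvable by a convergent Neumann series, ‖(I + 𝔎R)⁻¹‖»; the junction `T⁻¹(k, φ) = Hk + L⁻¹φ` between
# `…QuadraticFibreMinimiser`'s propagator `H` and the chart map `T` asked for at leaf-04 g152's ι-2; [folklore])

Cell `pub-balaban`, sub-cell `t4`, spine estimate NE7b (`T4WeightBudget.RelWeightBound`; the cell's OWN estimate — NOT PRINTED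
in [Bałaban 1983–89], NOT PROVED).  Crux-route work under `Spine/NE7b/` by leaf-03 (CRUX team (2), FREEZE (0) crux-prover clause).
NOTHING of Bałaban's is named, asserted, valued or discharged; no `T4Continuum/Support` leaf typed; no `def`; zero `sorry`.  Imports
Mathlib ONLY (`LaxMilgram`, `InnerProductSpace.Dual`) — independent of the `Spine/NE7b` olean frontier: it imports neither
`…QuadraticFibreMinimiser` (QFM) nor `…HardStepChartRadius` (HSCR) ∕ `…HardStepBranchDeriv` (HSBD), whose letters it produces in
their own shapes.

WHY.  HSCR (leaf-04 g152) makes the hard step's background field quantitative — a branch `σ` of constrained critical points on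
`closedBall (Dδ₀) ((N⁻¹ − c) r)`, `(N⁻¹ − c)⁻¹`-Lipschitz — and HSBD (leaf-04 g153) differentiates it, BOTH from two DISPLAYED
letters about the augmented Hessian at the base point: an equivalence `T : E ≃L[ℝ] F × (ker D →L[ℝ] ℝ)` with
`T h = (D h, (V″ δ₀ h).comp (ker D).subtypeL)`, and the pointwise inverse bound `‖T⁻¹ y‖ ≤ N‖y‖`.  Print's (70)–(71) obtain
exactly such an `N` from positivity of the quadratic form on the slice.  QFM (leaf-03 g147) proved, from the KERNEL COERCIVITY
letter `m‖κ‖² ≤ Q κ κ` (`κ ∈ ker D`, `0 < m`) and a right inverse `M` of `D`, that the `Q`-orthogonal right inverse `H` of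
`D` exists with `‖H k‖ ≤ (1 + ‖Q‖∕m)‖M k‖` — the `(k, 0)` column of `T⁻¹`.  This file does the whole inverse: the `(0, φ)`
column is the Lax–Milgram solve on `ker D` (`‖·‖ ≤ ‖φ‖∕m`), so `T` IS an equivalence and `N := (1 + ‖Q‖∕m)‖M‖ + m⁻¹`
works (sup norm on the product).  With it, HSCR ∕ HSBD run on the letters `(Q = V″ δ₀, D, M, m)` of the constrained
second-order files (CVS ∕ CVW ∕ CSTF ∕ QFM) with NO equivalence displayed.

WHAT IS PROVED ([folklore]; the nonsingularity of the KKT ∕ bordered operator under the second-order sufficient condition —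
e.g. Nocedal–Wright, *Numerical Optimization* Lemma 16.1; Griva–Nash–Sofer, *Linear and Nonlinear Optimization* §14 — here
in a real Hilbert space with the inverse BOUND, via Lax–Milgram on the closed subspace `ker D`).  Standing letters: `E` a real
inner-product space (complete where said), `F` real normed, `Q : E →L[ℝ] E →L[ℝ] ℝ` (NO symmetry asked), `D : E →L[ℝ] F`,
`M : F →L[ℝ] E` with `D (M w) = w`, `0 < m`, `∀ κ, D κ = 0 → m‖κ‖² ≤ Q κ κ`; `ι := (ker D).subtypeL`.
* §1 THE A-PRIORI BOUND (no completeness): **`norm_le_of_kerCoercive`** — for EVERY `h`,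
  `‖h‖ ≤ (1 + ‖Q‖∕m)·‖M (D h)‖ + m⁻¹·‖(Q h).comp ι‖` (test the coercivity at `h − M(Dh) ∈ ker D`);
  `norm_le_of_kerCoercive_sup` — `‖h‖ ≤ ((1 + ‖Q‖∕m)‖M‖ + m⁻¹)·‖(D h, (Q h).comp ι)‖`; `eq_of_aug_eq` (injectivity);
  helpers `sub_rightInverse_mem_ker`, `comp_subtypeL_apply`, `le_div_of_mul_sq_le`.
* §2 SOLVABILITY (Lax–Milgram on `ker D`, `E` complete): **`exists_aug_eq`** — every `(k, φ) : F × (ker D →L[ℝ] ℝ)` is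
  `(D h, (Q h).comp ι)` for some `h` (namely `h = M k + z`, `z ∈ ker D` solving `Q z w = φ w − Q (M k) w` on `ker D`).
* §3 THE END **`exists_augHessian_equiv`** — `∃ T : E ≃L[ℝ] F × (ker D →L[ℝ] ℝ)`, `∀ h, T h = (D h, (Q h).comp ι)` and
  `∀ y, ‖T.symm y‖ ≤ ((1 + ‖Q‖∕m)‖M‖ + m⁻¹)·‖y‖`; **`exists_augHessian_equiv_nnreal`** — the same for ANY `N : ℝ≥0` with
  `(1 + ‖Q‖∕m)‖M‖ + m⁻¹ ≤ N`: `‖T.symm y‖ ≤ N * ‖y‖` — HSCR `exists_criticalBranch_chart_ker`'s binders `T`, `hT`, `hN`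
  VERBATIM at `V'' δ₀ := Q` (its smallness letter then reads `c < N⁻¹`).
* §4 THE TWO COLUMNS OF `T⁻¹` (for ANY `T` with the §3 reading `hT`, no completeness): `fst_aug_symm` ∕ `snd_aug_symm`
  (`D (T⁻¹ y) = y.1`, `(Q (T⁻¹ y)).comp ι = y.2`); **`norm_symm_inl_le`** — `‖T⁻¹ (k, 0)‖ ≤ (1 + ‖Q‖∕m)‖M k‖` and
  `aug_symm_inl_orthogonal` — `Q (T⁻¹ (k, 0)) κ = 0` on `ker D`: the `(k, 0)` column is QFM's propagator `H` (its
  `exists_propagator` letters, hence equal to it by QFM `propagator_unique` — not imported); **`norm_symm_inr_le`** —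
  `‖T⁻¹ (0, φ)‖ ≤ m⁻¹‖φ‖` with `T⁻¹ (0, φ) ∈ ker D` (`aug_symm_inr_mem_ker`): the Lax–Milgram column.
* §5 toy (`example`): `E = F = ℝ`, `D = M = id`, `Q x y = x·y`, `m = 1`: §1 reads `‖h‖ ≤ (1 + ‖Q‖∕1)‖h‖ + 1·‖(Q h).comp ι‖`.

NOT HERE (honest): which `Q, D, M, m` are Bałaban's (the Hessian of the small-field action on the Landau ∕ axial slice and the
averaging constraint — (A3) ∕ (A1c), NC-NE7b-α UNRULED; in print `N` is (71)'s constant); the smallness letter `c < N⁻¹` of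
HSCR (the small-field variation of the Hessian — a SEPARATE letter); symmetric-`Q` refinements (for symmetric positive `Q` the
two columns are `Q`-orthogonal and sharper constants hold — not needed by HSCR); general test directions `ι : K →L[ℝ] E` other
than the kernel inclusion (HSCR's `exists_criticalBranch_chart` — an equivalence then needs `ι` to be an isomorphism onto
`ker D`); anything of Bałaban's.  BY-NAME EFFECT ON THE WALL: NONE.  NE7b NOT PRINTED ∕ NOT PROVED; spine PROVED 0∕9; rung (B)+1
on a FINITE torus — NOT infinite volume, NOT the mass gap, NOT Clay.  HONEST DEPENDENCY: continuum YM on T⁴ ⇐ BetaPertH ∧ nine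
spine estimates (0/9 proved); BetaPertH ⇐ (D1) ∧ (D4) ∧ CAP+tail; G-an2-4 gates asym, D1 and NE2∕3∕4.
-/

set_option autoImplicit false

noncomputable section

namespace Summit.QuantumFields.BalabanUV.T4Continuum.NE7b.AugmentedHessianEquivalence

open scoped NNReal

variable {E F : Type*} [NormedAddCommGroup E] [InnerProductSpace ℝ E] [NormedAddCommGroup F] [NormedSpace ℝ F]

/-! ## §1. The a-priori bound from kernel coercivity (no completeness) -/

/-- Membership in `ker D` of the defect `h − M (D h)` for a right inverse `M`. [folklore] -/
theorem sub_rightInverse_mem_ker {D : E →L[ℝ] F} {M : F →L[ℝ] E} (hM : ∀ w, D (M w) = w) (h : E) :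
    h - M (D h) ∈ D.ker := by
  rw [LinearMap.mem_ker, ContinuousLinearMap.coe_coe, map_sub, hM, sub_self]

/-- The restricted functional reads `Q h` on kernel vectors: `((Q h).comp ι) ⟨κ, _⟩ = Q h κ`. [folklore] -/
theorem comp_subtypeL_apply (Q : E →L[ℝ] E →L[ℝ] ℝ) (D : E →L[ℝ] F) (h : E) (z : D.ker) :
    ((Q h).comp D.ker.subtypeL) z = Q h (z : E) := rfl

/-- A coercivity step: `m t² ≤ a t` with `0 < m`, `0 ≤ a`, `0 ≤ t` gives `t ≤ a∕m`. [folklore] -/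
theorem le_div_of_mul_sq_le {m a t : ℝ} (hm : 0 < m) (ha : 0 ≤ a) (ht : 0 ≤ t) (h : m * t ^ 2 ≤ a * t) :
    t ≤ a / m := by
  rw [le_div_iff₀ hm]
  rcases ht.eq_or_lt with hz | hpos
  · rw [← hz, zero_mul]; exact ha
  · have h' : m * t * t ≤ a * t := by rw [mul_assoc, ← sq]; exact h
    rw [mul_comm]
    exact le_of_mul_le_mul_right h' hpos

/-- **THE A-PRIORI BOUND.**  Kernel coercivity `m‖κ‖² ≤ Q κ κ` on `ker D` (`0 < m`) and a right inverse `M` of `D` give, for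
EVERY `h : E`, `‖h‖ ≤ (1 + ‖Q‖∕m)·‖M (D h)‖ + m⁻¹·‖(Q h).comp ι‖`: with `z := h − M(Dh) ∈ ker D`,
`m‖z‖² ≤ Q z z = Q h z − Q (M(Dh)) z ≤ (‖(Q h).comp ι‖ + ‖Q‖‖M(Dh)‖)‖z‖`. [folklore] -/
theorem norm_le_of_kerCoercive {Q : E →L[ℝ] E →L[ℝ] ℝ} {D : E →L[ℝ] F} {M : F →L[ℝ] E} (hM : ∀ w, D (M w) = w)
    {m : ℝ} (hm : 0 < m) (hco : ∀ κ, D κ = 0 → m * ‖κ‖ ^ 2 ≤ Q κ κ) (h : E) :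
    ‖h‖ ≤ (1 + ‖Q‖ / m) * ‖M (D h)‖ + m⁻¹ * ‖(Q h).comp D.ker.subtypeL‖ := by
  set z : E := h - M (D h) with hz
  have hzmem : z ∈ D.ker := sub_rightInverse_mem_ker hM h
  have hzker : D z = 0 := by simpa [LinearMap.mem_ker] using hzmem
  set φ : D.ker →L[ℝ] ℝ := (Q h).comp D.ker.subtypeL with hφ
  -- the coercivity at `z`, split along `z = h − M (D h)` in the first slot
  have h1 : m * ‖z‖ ^ 2 ≤ Q h z - Q (M (D h)) z := by
    have h0 := hco z hzker
    rwa [hz, map_sub Q h (M (D h)), sub_apply, ← hz] at h0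
  have h2 : Q h z ≤ ‖φ‖ * ‖z‖ := by
    have e : Q h z = φ ⟨z, hzmem⟩ := rfl
    rw [e]
    calc φ ⟨z, hzmem⟩ ≤ ‖φ ⟨z, hzmem⟩‖ := Real.le_norm_self _
      _ ≤ ‖φ‖ * ‖(⟨z, hzmem⟩ : D.ker)‖ := φ.le_opNorm _
      _ = ‖φ‖ * ‖z‖ := by rw [Submodule.coe_norm]
  have h3 : -(Q (M (D h)) z) ≤ ‖Q‖ * ‖M (D h)‖ * ‖z‖ := by
    calc -(Q (M (D h)) z) ≤ ‖Q (M (D h)) z‖ := by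
          rw [Real.norm_eq_abs]; exact neg_le_abs _
      _ ≤ ‖Q (M (D h))‖ * ‖z‖ := (Q (M (D h))).le_opNorm _
      _ ≤ ‖Q‖ * ‖M (D h)‖ * ‖z‖ := mul_le_mul_of_nonneg_right (Q.le_opNorm _) (norm_nonneg _)
  have h4 : m * ‖z‖ ^ 2 ≤ (‖φ‖ + ‖Q‖ * ‖M (D h)‖) * ‖z‖ := by
    have : Q h z - Q (M (D h)) z ≤ ‖φ‖ * ‖z‖ + ‖Q‖ * ‖M (D h)‖ * ‖z‖ := by linarith
    linarith
  have h5 : ‖z‖ ≤ (‖φ‖ + ‖Q‖ * ‖M (D h)‖) / m := le_div_of_mul_sq_le hm (by positivity) (norm_nonneg _) h4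
  have e : h = M (D h) + z := by rw [hz]; abel
  calc ‖h‖ = ‖M (D h) + z‖ := by rw [← e]
    _ ≤ ‖M (D h)‖ + ‖z‖ := norm_add_le _ _
    _ ≤ ‖M (D h)‖ + (‖φ‖ + ‖Q‖ * ‖M (D h)‖) / m := by linarith
    _ = (1 + ‖Q‖ / m) * ‖M (D h)‖ + m⁻¹ * ‖φ‖ := by
        field_simp
        ring

/-- The a-priori bound in the SUP NORM of the pair `(D h, (Q h).comp ι)`:
`‖h‖ ≤ ((1 + ‖Q‖∕m)‖M‖ + m⁻¹)·‖(D h, (Q h).comp ι)‖`. [folklore] -/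
theorem norm_le_of_kerCoercive_sup {Q : E →L[ℝ] E →L[ℝ] ℝ} {D : E →L[ℝ] F} {M : F →L[ℝ] E} (hM : ∀ w, D (M w) = w)
    {m : ℝ} (hm : 0 < m) (hco : ∀ κ, D κ = 0 → m * ‖κ‖ ^ 2 ≤ Q κ κ) (h : E) :
    ‖h‖ ≤ ((1 + ‖Q‖ / m) * ‖M‖ + m⁻¹) * ‖(D h, (Q h).comp D.ker.subtypeL)‖ := by
  have hC : 0 ≤ 1 + ‖Q‖ / m := by positivity
  have hk : ‖D h‖ ≤ ‖(D h, (Q h).comp D.ker.subtypeL)‖ := norm_fst_le (D h, (Q h).comp D.ker.subtypeL)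
  have hφ : ‖(Q h).comp D.ker.subtypeL‖ ≤ ‖(D h, (Q h).comp D.ker.subtypeL)‖ :=
    norm_snd_le (D h, (Q h).comp D.ker.subtypeL)
  calc ‖h‖ ≤ (1 + ‖Q‖ / m) * ‖M (D h)‖ + m⁻¹ * ‖(Q h).comp D.ker.subtypeL‖ := norm_le_of_kerCoercive hM hm hco h
    _ ≤ (1 + ‖Q‖ / m) * (‖M‖ * ‖(D h, (Q h).comp D.ker.subtypeL)‖) +
          m⁻¹ * ‖(D h, (Q h).comp D.ker.subtypeL)‖ := by
        gcongr
        · exact (M.le_opNorm _).trans (mul_le_mul_of_nonneg_left hk (norm_nonneg _))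
    _ = ((1 + ‖Q‖ / m) * ‖M‖ + m⁻¹) * ‖(D h, (Q h).comp D.ker.subtypeL)‖ := by ring

/-- INJECTIVITY of the augmented Hessian `h ↦ (D h, (Q h).comp ι)` under kernel coercivity. [folklore] -/
theorem eq_of_aug_eq {Q : E →L[ℝ] E →L[ℝ] ℝ} {D : E →L[ℝ] F} {M : F →L[ℝ] E} (hM : ∀ w, D (M w) = w)
    {m : ℝ} (hm : 0 < m) (hco : ∀ κ, D κ = 0 → m * ‖κ‖ ^ 2 ≤ Q κ κ) {h h' : E} (hD : D h = D h')
    (hQ : (Q h).comp D.ker.subtypeL = (Q h').comp D.ker.subtypeL) : h = h' := by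
  have hb := norm_le_of_kerCoercive hM hm hco (h - h')
  have e1 : D (h - h') = 0 := by rw [map_sub, hD, sub_self]
  have e2 : (Q (h - h')).comp D.ker.subtypeL = 0 := by
    rw [map_sub, ContinuousLinearMap.sub_comp, hQ, sub_self]
  rw [e1, e2, map_zero, norm_zero, ContinuousLinearMap.opNorm_zero, mul_zero, mul_zero, add_zero] at hb
  exact sub_eq_zero.mp (norm_le_zero_iff.mp hb)

/-! ## §2. Solvability: Lax–Milgram on the closed subspace `ker D` -/

/-- **SOLVABILITY.**  In a real Hilbert space, kernel coercivity and a right inverse `M` of `D` make the augmented Hessian ONTO: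
for every `k : F` and `φ : ker D →L[ℝ] ℝ` there is `h` with `D h = k` and `(Q h).comp ι = φ` — `h = M k + z` with `z ∈ ker D`
the Lax–Milgram solution of `Q z w = φ w − Q (M k) w` (`w ∈ ker D`). [folklore] -/
theorem exists_aug_eq [CompleteSpace E] {Q : E →L[ℝ] E →L[ℝ] ℝ} {D : E →L[ℝ] F} {M : F →L[ℝ] E}
    (hM : ∀ w, D (M w) = w) {m : ℝ} (hm : 0 < m) (hco : ∀ κ, D κ = 0 → m * ‖κ‖ ^ 2 ≤ Q κ κ)
    (k : F) (φ : D.ker →L[ℝ] ℝ) :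
    ∃ h : E, D h = k ∧ (Q h).comp D.ker.subtypeL = φ := by
  haveI : CompleteSpace D.ker := (ContinuousLinearMap.isClosed_ker D).completeSpace_coe
  have hmemD : ∀ u : D.ker, D (u : E) = 0 := fun u => by
    have hu := u.2
    rw [LinearMap.mem_ker] at hu
    exact hu
  obtain ⟨B, hB_apply⟩ : ∃ B : D.ker →L[ℝ] D.ker →L[ℝ] ℝ, ∀ u w : D.ker, B u w = Q (u : E) (w : E) :=
    ⟨Q.bilinearComp D.ker.subtypeL D.ker.subtypeL, fun u w => rfl⟩
  have hB : IsCoercive B := by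
    refine ⟨m, hm, fun u => ?_⟩
    rw [hB_apply, mul_assoc, ← sq]
    exact hco _ (hmemD u)
  -- the right-hand side `φ − Q (M k)|_{ker D}` and its Riesz vector
  set f : D.ker →L[ℝ] ℝ := φ - (Q (M k)).comp D.ker.subtypeL with hf
  have hf_apply : ∀ w : D.ker, f w = φ w - Q (M k) (w : E) := fun w => rfl
  obtain ⟨y, hy⟩ : ∃ y : D.ker, ∀ w : D.ker, @inner ℝ _ _ y w = f w :=
    ⟨(InnerProductSpace.toDual ℝ D.ker).symm f, fun w => InnerProductSpace.toDual_symm_apply⟩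
  obtain ⟨z, hz⟩ : ∃ z : D.ker, hB.continuousLinearEquivOfBilin z = y :=
    ⟨hB.continuousLinearEquivOfBilin.symm y, ContinuousLinearEquiv.apply_symm_apply _ _⟩
  have hBz : ∀ w : D.ker, Q (z : E) (w : E) = φ w - Q (M k) (w : E) := fun w => by
    rw [← hB_apply, ← hB.continuousLinearEquivOfBilin_apply, hz, hy, hf_apply]
  refine ⟨M k + (z : E), by rw [map_add, hM, hmemD z, add_zero], ?_⟩
  ext w
  rw [comp_subtypeL_apply, map_add, add_apply, hBz]
  ring

/-! ## §3. The END: the augmented Hessian is an equivalence with an explicit inverse bound -/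

/-- **THE AUGMENTED HESSIAN IS AN EQUIVALENCE WITH `‖T⁻¹ y‖ ≤ ((1 + ‖Q‖∕m)‖M‖ + m⁻¹)‖y‖.**  Real Hilbert `E`, real normed `F`,
`Q : E →L E →L ℝ` with `m‖κ‖² ≤ Q κ κ` on `ker D` (`0 < m`), `D (M w) = w` ⟹ there is `T : E ≃L[ℝ] F × (ker D →L[ℝ] ℝ)` with
`T h = (D h, (Q h).comp (ker D).subtypeL)` and the pointwise inverse bound in the sup norm. [folklore] -/
theorem exists_augHessian_equiv [CompleteSpace E] {Q : E →L[ℝ] E →L[ℝ] ℝ} {D : E →L[ℝ] F} {M : F →L[ℝ] E}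
    (hM : ∀ w, D (M w) = w) {m : ℝ} (hm : 0 < m) (hco : ∀ κ, D κ = 0 → m * ‖κ‖ ^ 2 ≤ Q κ κ) :
    ∃ T : E ≃L[ℝ] F × (D.ker →L[ℝ] ℝ),
      (∀ h, T h = (D h, (Q h).comp D.ker.subtypeL)) ∧
      ∀ y, ‖T.symm y‖ ≤ ((1 + ‖Q‖ / m) * ‖M‖ + m⁻¹) * ‖y‖ := by
  -- the forward map as a continuous linear map
  set R : (E →L[ℝ] ℝ) →L[ℝ] (D.ker →L[ℝ] ℝ) := (ContinuousLinearMap.compL ℝ D.ker E ℝ).flip D.ker.subtypeL with hR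
  have hRapply : ∀ L : E →L[ℝ] ℝ, R L = L.comp D.ker.subtypeL := fun L => rfl
  set T₀ : E →L[ℝ] F × (D.ker →L[ℝ] ℝ) := D.prod (R.comp (Q : E →L[ℝ] E →L[ℝ] ℝ)) with hT₀
  have hT₀apply : ∀ h, T₀ h = (D h, (Q h).comp D.ker.subtypeL) := fun h => rfl
  -- the inverse as a function, by §2
  choose g hgD hgQ using fun y : F × (D.ker →L[ℝ] ℝ) => exists_aug_eq hM hm hco y.1 y.2
  have hTg : ∀ y, T₀ (g y) = y := fun y => by
    rw [hT₀apply, hgD, hgQ]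
  have huniq : ∀ y x, T₀ x = y → x = g y := fun y x hx => by
    rw [hT₀apply] at hx
    have hx' := hx.trans (hTg y).symm
    rw [hT₀apply, Prod.mk.injEq] at hx'
    exact eq_of_aug_eq hM hm hco hx'.1 hx'.2
  -- linearity from uniqueness
  have hadd : ∀ y y', g (y + y') = g y + g y' := fun y y' =>
    (huniq _ _ (by rw [map_add, hTg, hTg])).symm
  have hsmul : ∀ (c : ℝ) (y), g (c • y) = c • g y := fun c y =>
    (huniq _ _ (by rw [map_smul, hTg])).symm
  obtain ⟨glin, hglin⟩ : ∃ glin : F × (D.ker →L[ℝ] ℝ) →ₗ[ℝ] E, ∀ y, glin y = g y :=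
    ⟨{ toFun := g, map_add' := hadd, map_smul' := hsmul }, fun y => rfl⟩
  -- boundedness from §1 (the structure literal keeps the product's own topology instance; `mkContinuous` would not unify)
  have hbound : ∀ y, ‖g y‖ ≤ ((1 + ‖Q‖ / m) * ‖M‖ + m⁻¹) * ‖y‖ := fun y => by
    have hb := norm_le_of_kerCoercive_sup hM hm hco (g y)
    rw [hgD, hgQ] at hb
    exact hb
  have hcont : Continuous glin :=
    AddMonoidHomClass.continuous_of_bound glin ((1 + ‖Q‖ / m) * ‖M‖ + m⁻¹) fun y => by rw [hglin]; exact hbound y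
  obtain ⟨S, hSapply⟩ : ∃ S : F × (D.ker →L[ℝ] ℝ) →L[ℝ] E, ∀ y, S y = g y :=
    ⟨{ toLinearMap := glin, cont := hcont }, fun y => hglin y⟩
  refine ⟨ContinuousLinearEquiv.equivOfInverse T₀ S (fun x => ?_) (fun y => ?_), fun h => rfl, fun y => ?_⟩
  · show S (T₀ x) = x
    rw [hSapply]
    exact (huniq _ _ rfl).symm
  · show T₀ (S y) = y
    rw [hSapply]
    exact hTg y
  · rw [ContinuousLinearEquiv.symm_equivOfInverse, ContinuousLinearEquiv.equivOfInverse_apply, hSapply]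
    exact hbound y

/-- **THE SAME IN `ℝ≥0` CURRENCY** — `…HardStepChartRadius.exists_criticalBranch_chart_ker`'s binders `T`, `hT`, `hN` VERBATIM at
`V'' δ₀ := Q`, for ANY `N : ℝ≥0` dominating the constant: `(1 + ‖Q‖∕m)‖M‖ + m⁻¹ ≤ N` ⟹
`∃ T, (∀ h, T h = (D h, (Q h).comp D.ker.subtypeL)) ∧ ∀ y, ‖T.symm y‖ ≤ N * ‖y‖` (HSCR's smallness letter then reads
`c < N⁻¹`). [folklore] -/
theorem exists_augHessian_equiv_nnreal [CompleteSpace E] {Q : E →L[ℝ] E →L[ℝ] ℝ} {D : E →L[ℝ] F} {M : F →L[ℝ] E}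
    (hM : ∀ w, D (M w) = w) {m : ℝ} (hm : 0 < m) (hco : ∀ κ, D κ = 0 → m * ‖κ‖ ^ 2 ≤ Q κ κ)
    {N : ℝ≥0} (hN : (1 + ‖Q‖ / m) * ‖M‖ + m⁻¹ ≤ (N : ℝ)) :
    ∃ T : E ≃L[ℝ] F × (D.ker →L[ℝ] ℝ),
      (∀ h, T h = (D h, (Q h).comp D.ker.subtypeL)) ∧ ∀ y : F × (D.ker →L[ℝ] ℝ), ‖T.symm y‖ ≤ N * ‖y‖ := by
  obtain ⟨T, hT, hTN⟩ := exists_augHessian_equiv hM hm hco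
  exact ⟨T, hT, fun y => (hTN y).trans (mul_le_mul_of_nonneg_right hN (norm_nonneg y))⟩

/-! ## §4. The two columns of `T⁻¹` (any `T` with the §3 reading; no completeness) -/

/-- `D (T⁻¹ y) = y.1` for any `T` reading the augmented Hessian. [folklore] -/
theorem fst_aug_symm {Q : E →L[ℝ] E →L[ℝ] ℝ} {D : E →L[ℝ] F} (T : E ≃L[ℝ] F × (D.ker →L[ℝ] ℝ))
    (hT : ∀ h, T h = (D h, (Q h).comp D.ker.subtypeL)) (y : F × (D.ker →L[ℝ] ℝ)) : D (T.symm y) = y.1 := by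
  have e := hT (T.symm y)
  rw [ContinuousLinearEquiv.apply_symm_apply] at e
  exact (congrArg Prod.fst e).symm

/-- `(Q (T⁻¹ y)).comp ι = y.2` for any `T` reading the augmented Hessian. [folklore] -/
theorem snd_aug_symm {Q : E →L[ℝ] E →L[ℝ] ℝ} {D : E →L[ℝ] F} (T : E ≃L[ℝ] F × (D.ker →L[ℝ] ℝ))
    (hT : ∀ h, T h = (D h, (Q h).comp D.ker.subtypeL)) (y : F × (D.ker →L[ℝ] ℝ)) :
    (Q (T.symm y)).comp D.ker.subtypeL = y.2 := by
  have e := hT (T.symm y)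
  rw [ContinuousLinearEquiv.apply_symm_apply] at e
  exact (congrArg Prod.snd e).symm

/-- THE `(k, 0)` COLUMN IS `Q`-ORTHOGONAL TO `ker D`: `Q (T⁻¹ (k, 0)) κ = 0` for `D κ = 0` — with `fst_aug_symm`, the two letters of
`…QuadraticFibreMinimiser.exists_propagator` for `k ↦ T⁻¹ (k, 0)`. [folklore] -/
theorem aug_symm_inl_orthogonal {Q : E →L[ℝ] E →L[ℝ] ℝ} {D : E →L[ℝ] F} (T : E ≃L[ℝ] F × (D.ker →L[ℝ] ℝ))
    (hT : ∀ h, T h = (D h, (Q h).comp D.ker.subtypeL)) (k : F) (κ : E) (hκ : D κ = 0) :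
    Q (T.symm (k, 0)) κ = 0 := by
  have hκmem : κ ∈ D.ker := LinearMap.mem_ker.mpr hκ
  have e := snd_aug_symm T hT (k, 0)
  have e' := congrArg (fun L : D.ker →L[ℝ] ℝ => L ⟨κ, hκmem⟩) e
  simpa [comp_subtypeL_apply] using e'

/-- **`‖T⁻¹ (k, 0)‖ ≤ (1 + ‖Q‖∕m)·‖M k‖`** — QFM's propagator bound for the `(k, 0)` column (§1 with `φ = 0`). [folklore] -/
theorem norm_symm_inl_le {Q : E →L[ℝ] E →L[ℝ] ℝ} {D : E →L[ℝ] F} {M : F →L[ℝ] E} (hM : ∀ w, D (M w) = w)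
    {m : ℝ} (hm : 0 < m) (hco : ∀ κ, D κ = 0 → m * ‖κ‖ ^ 2 ≤ Q κ κ) (T : E ≃L[ℝ] F × (D.ker →L[ℝ] ℝ))
    (hT : ∀ h, T h = (D h, (Q h).comp D.ker.subtypeL)) (k : F) :
    ‖T.symm (k, 0)‖ ≤ (1 + ‖Q‖ / m) * ‖M k‖ := by
  have hb := norm_le_of_kerCoercive hM hm hco (T.symm (k, 0))
  rw [fst_aug_symm T hT, snd_aug_symm T hT] at hb
  simpa [ContinuousLinearMap.opNorm_zero] using hb

/-- THE `(0, φ)` COLUMN LIES IN `ker D`. [folklore] -/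
theorem aug_symm_inr_mem_ker {Q : E →L[ℝ] E →L[ℝ] ℝ} {D : E →L[ℝ] F} (T : E ≃L[ℝ] F × (D.ker →L[ℝ] ℝ))
    (hT : ∀ h, T h = (D h, (Q h).comp D.ker.subtypeL)) (φ : D.ker →L[ℝ] ℝ) : D (T.symm (0, φ)) = 0 :=
  fst_aug_symm T hT (0, φ)

/-- **`‖T⁻¹ (0, φ)‖ ≤ m⁻¹·‖φ‖`** — the Lax–Milgram column (§1 with `k = 0`). [folklore] -/
theorem norm_symm_inr_le {Q : E →L[ℝ] E →L[ℝ] ℝ} {D : E →L[ℝ] F} {M : F →L[ℝ] E} (hM : ∀ w, D (M w) = w)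
    {m : ℝ} (hm : 0 < m) (hco : ∀ κ, D κ = 0 → m * ‖κ‖ ^ 2 ≤ Q κ κ) (T : E ≃L[ℝ] F × (D.ker →L[ℝ] ℝ))
    (hT : ∀ h, T h = (D h, (Q h).comp D.ker.subtypeL)) (φ : D.ker →L[ℝ] ℝ) :
    ‖T.symm (0, φ)‖ ≤ m⁻¹ * ‖φ‖ := by
  have hb := norm_le_of_kerCoercive hM hm hco (T.symm (0, φ))
  rw [fst_aug_symm T hT, snd_aug_symm T hT] at hb
  simpa using hb

/-! ## §5. Toy -/

/-- Toy: `E = F = ℝ`, `D = M = id`, `Q x y = x·y`, `m = 1` (`ker D = 0`, the coercivity letter is vacuous-true):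
§1 reads `‖h‖ ≤ (1 + ‖Q‖∕1)·‖h‖ + 1⁻¹·‖(Q h).comp ι‖`. [folklore] -/
example (h : ℝ) :
    ‖h‖ ≤ (1 + ‖ContinuousLinearMap.mul ℝ ℝ‖ / 1) * ‖(ContinuousLinearMap.id ℝ ℝ) ((ContinuousLinearMap.id ℝ ℝ) h)‖ +
      (1 : ℝ)⁻¹ * ‖(ContinuousLinearMap.mul ℝ ℝ h).comp (ContinuousLinearMap.id ℝ ℝ).ker.subtypeL‖ :=
  norm_le_of_kerCoercive (Q := ContinuousLinearMap.mul ℝ ℝ) (D := ContinuousLinearMap.id ℝ ℝ)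
    (M := ContinuousLinearMap.id ℝ ℝ) (fun w => rfl) one_pos
    (fun κ hκ => by simp [show κ = 0 from hκ]) h

end Summit.QuantumFields.BalabanUV.T4Continuum.NE7b.AugmentedHessianEquivalence
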